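import Summits.MatrixMultiplication.OmegaCensus.STPPKernelListerOrderN36

/-!
# ω-census (abelian STPP census): glue for cross-reading coset clashes — negated families, difference sets in cosets, `Y°`-blocks (kernel)

HONEST FRAMING (pub-omega census; verbatim): lottery ticket; floor = certified bounds/negative ranges.
Census STRUCTURE (seat pub-omega-stpp-2 gen 31, 2026-08-29), family (b2).  Small lemmas used by the GENERATED per-pattern coset-clash kills
(`STPPCosetClashKillsN*.lean`): un-negating a coset containment obtained in an odd role reading (`subset_coset_of_neg_subset`), the difference set
`D X Y k = {y − x}` of two sets in cosets of one subgroup carrier lies in one coset (`D_subset_coset`), and the two block containments out of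
`⋃_{k≠i}(Z_k − Y_k) ⊆ y + K′` (`last_subset_coset_of_DU`, `mid_subset_coset_of_DU`, any family).  Nothing here is progress on `ω`.
-/

open Finset
open scoped Pointwise

namespace Summit.MatrixMultiplication.OmegaCensus.CubeNB

open Literature.Combinatorics.Additive
open Summit.MatrixMultiplication.OmegaCensus.STPPKneser

variable {H : Type*} [AddCommGroup H] [DecidableEq H] {N : ℕ}

/-- From `−S ⊆ t + K` (`K` a subgroup carrier): `S ⊆ −t + K`. [folklore] -/
theorem subset_coset_of_neg_subset {K S : Finset H} (hK : IsSubgroupCarrier K) {t : H} (h : -S ⊆ t +ᵥ K) : S ⊆ (-t) +ᵥ K := by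
  intro x hx
  have hnx : -x ∈ -S := Finset.mem_neg'.2 (by simpa using hx)
  have h1 := (hK.mem_coset_iff).1 (h hnx)
  rw [hK.mem_coset_iff]
  have : x - -t = -(-x - t) := by abel
  rw [this]
  exact hK.neg_mem h1

/-- Two sets in cosets of one subgroup carrier: their difference set `D X Y k = {y − x}` lies in one coset. [folklore] -/
theorem D_subset_coset {X Y : Fin N → Finset H} {K : Finset H} (hK : IsSubgroupCarrier K) {k : Fin N} {s t : H}
    (hX : X k ⊆ s +ᵥ K) (hY : Y k ⊆ t +ᵥ K) : D X Y k ⊆ (t - s) +ᵥ K := by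
  intro d hd
  obtain ⟨x, hx, y, hy, rfl⟩ := mem_D.1 hd
  have h1 := (hK.mem_coset_iff).1 (hX hx)
  have h2 := (hK.mem_coset_iff).1 (hY hy)
  rw [hK.mem_coset_iff]
  have : y - x - (t - s) = (y - t) - (x - s) := by abel
  rw [this]
  exact hK.sub_mem h2 h1

/-- From `⋃_{k≠i}(Z_k − Y_k) ⊆ y + K′` and `y₀ ∈ Y_k` (`k ≠ i`): `Z_k ⊆ (y + y₀) + K′`. [folklore] -/
theorem last_subset_coset_of_DU {Y Z : Fin N → Finset H} {K' : Finset H} (hK' : IsSubgroupCarrier K') {i k : Fin N} (hk : k ≠ i)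
    {y : H} (h : DU Y Z (univ.erase i) ⊆ y +ᵥ K') {y₀ : H} (hy₀ : y₀ ∈ Y k) : Z k ⊆ (y + y₀) +ᵥ K' := by
  intro c hc
  have hmem : c - y₀ ∈ DU Y Z (univ.erase i) :=
    Finset.mem_biUnion.2 ⟨k, Finset.mem_erase.2 ⟨hk, Finset.mem_univ _⟩, mem_D.2 ⟨y₀, hy₀, c, hc, rfl⟩⟩
  have h1 := (hK'.mem_coset_iff).1 (h hmem)
  rw [hK'.mem_coset_iff]
  have : c - (y + y₀) = c - y₀ - y := by abel
  rw [this]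
  exact h1

/-- From `⋃_{k≠i}(Z_k − Y_k) ⊆ y + K′` and `z₀ ∈ Z_k` (`k ≠ i`): `Y_k ⊆ (z₀ − y) + K′`. [folklore] -/
theorem mid_subset_coset_of_DU {Y Z : Fin N → Finset H} {K' : Finset H} (hK' : IsSubgroupCarrier K') {i k : Fin N} (hk : k ≠ i)
    {y : H} (h : DU Y Z (univ.erase i) ⊆ y +ᵥ K') {z₀ : H} (hz₀ : z₀ ∈ Z k) : Y k ⊆ (z₀ - y) +ᵥ K' := by
  intro b hb
  have hmem : z₀ - b ∈ DU Y Z (univ.erase i) :=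
    Finset.mem_biUnion.2 ⟨k, Finset.mem_erase.2 ⟨hk, Finset.mem_univ _⟩, mem_D.2 ⟨b, hb, z₀, hz₀, rfl⟩⟩
  have h1 := (hK'.mem_coset_iff).1 (h hmem)
  rw [hK'.mem_coset_iff]
  have : b - (z₀ - y) = -(z₀ - b - y) := by abel
  rw [this]
  exact hK'.neg_mem h1

end Summit.MatrixMultiplication.OmegaCensus.CubeNB
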